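import Summits.QuantumFields.YangMills.Theorems.VirialFluxGapCentralSignPlug
import Summits.QuantumFields.YangMills.Theorems.VirialFluxGapCentralMassMonotonicityWindow
import Summits.QuantumFields.YangMills.Theorems.VirialFluxGapCentralFieldSmooth
import Summits.QuantumFields.YangMills.Theorems.VirialFluxGapCentralDriveWindow
import Summits.QuantumFields.YangMills.Theorems.VirialFluxGapCentralFieldDivergenceSharp
import HarnessLib

/-!
# Route `SwapVirialDeficit` ∕ `VirialFluxGap` (YangMills): the `δ`-FAMILY OF CENTRAL FIELD PACKAGES with the SHARP divergence `18L⁴ − 3 + δ`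
# and drive loss `ε_C·L⁴ ≤ δ` — the central input of the `δ`-rerun of the ⟨24141⟩ assembly (the (P) road to ⟨24196⟩ `ToronSoftnessSharp`)

LEAD ym-line-sfw-p2 g97 (cell ym-idea-1, free hands; `--supports stmt-QuantumFields-24196`; brick «S6-central» of the 2026-08-31 allocation).
The ⟨24141⟩ chain closed `PeriodicSoftness` with the explicit central field `centralCoeff L σ σ₄` (w3 g59), sign selectors plugged in (w2, fcl-p3
Part VII), the window choice `ρ = √t_C = (10¹²L¹⁴)⁻¹` (fcl-p3 ✓`ClosingArithmetic`) and the LAZY divergence count `18L⁴ − ½`.  Here the same field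
is packaged for EVERY `δ > 0` with the sharp count and a `δ`-small drive loss:

★★★ `centralFieldFamily_sharp` : `∀ δ > 0, ∃ K_C ≥ 1, ∃ q_C L₀, ∀ L ≥ L₀, ∃ ρ t_C N ε_C C,
  (K_C L^{q_C})⁻¹ ≤ ρ ≤ ½ ∧ (K_C L^{q_C})⁻¹ ≤ t_C ∧ 0 ≤ N ≤ K_C L^{q_C} ∧ 0 ≤ ε_C ∧ ε_C·L⁴ ≤ δ ∧ (∀ va, C va smooth) ∧
  ∀ x ∈ X_fix with the four regularity masses ≤ ρ² and F_fix x ≤ t_C: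
    (P2) 2(1−ε_C)F_fix x ≤ Σ_va C_va(M_x)·frameGrad fixFrameStd M_x va,
    (P3) Σ_va frameD (fixFrameStd va) (C va) M_x ≤ 18L⁴ − 3 + δ,
    (P4) −N√(F_fix x) ≤ Σ_va C_va(M_x)·∂_va linkMass k (M_x) (k < 3) and the same for seamMass`
— i.e. EXACTLY the «CentralFieldPackage» hypothesis of ✓`periodicSoftness_of_centralField` with `ε_C·L⁴ ≤ 1/400 ↦ 0 ≤ ε_C ∧ ε_C·L⁴ ≤ δ` and
`18L⁴ − ½ ↦ 18L⁴ − 3 + δ`, quantified over `δ` outside.  Choice: `d = min δ 1`, `ρ = d·(10¹²L¹⁴)⁻¹`, `t_C = ρ²`, `K_C = 10²⁴/d²`, `q_C = 28`, `N = 330L²`,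
`C va M = centralCoeff L (linkSign · M) (seamSign M) va M`; ingredients ✓`central_drive_window'` (P2, w2 g53 ∕ w3 g59), ✓`central_divergence_window_sharp`
(P3, this seat, from w2 g52's ✓`centralDiv_le_budget`), ✓`central_linkMass_bracket_lower_window` ∕ ✓`central_seamMass_bracket_lower_window` (P4, w2),
✓`contDiff_centralCoeff_sign`, and §2's `centralPackage_of_signPlug_le` (fcl-p3's ✓`centralPackage_of_signPlug` with a free divergence bound `B`).

* §1 closing arithmetic at scale `d ∈ (0,1]`: `closing_eps_bound_delta` (`ε_C·L⁴ ≤ d/400`), `closing_div_excess_delta` (`12(ρ+16L²ρ)² ≤ d/400`),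
  `closing_window_bounds_delta`;
* §2 `centralPackage_of_signPlug_le`;  §3 `centralFieldPackage_sharp_at` (one `L`, scale `d`) and ★★★ `centralFieldFamily_sharp`.

HONEST LABEL: packaging of landed central-field estimates with a `δ`-dependent window; the generic∕patching half of the `δ`-rerun (fcl-p3 g47,
files `…Sharp`) and the closing of ⟨24196⟩ are NOT here; ⟨24196⟩ ∕ ⟨24194⟩ ∕ ⟨24197⟩ OPEN; own crux ⟨22884⟩ OPEN (blocked-on ⟨19935⟩); the
Yang–Mills mass gap is NOT proved; no summit is proved by a line.  THEOREMS ONLY (0 `def`, 0 `sorry`), standard axioms.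
References: [cite: Luscher1983, §2]; [cite: CosteEtAl1985]; [folklore].
-/

set_option autoImplicit false

noncomputable section

open scoped Matrix BigOperators ContDiff Topology Quaternion
open MeasureTheory Set Matrix
open Literature.MathematicalPhysics.QuantumFieldTheory hiding SU2
open Literature.MathematicalPhysics.QuantumLattice

namespace Summit.QuantumFields.YangMills.Theorems.VirialFluxGap.FrameHessian

open Summit.QuantumFields.YangMills.Theorems.FemtoTransferGap
open Summit.QuantumFields.YangMills.Theorems.FemtoTransferGap.TT
open Summit.QuantumFields.YangMills.Theorems.FemtoTransferGap.TwoLattice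
open Summit.QuantumFields.YangMills.Theorems.FemtoTransferGap.TwoLattice.Flat
open Summit.QuantumFields.YangMills.Theorems.VirialFluxGap.RingDeficit
open Summit.QuantumFields.YangMills.Theorems.VirialFluxGap.FrameDerivative
open Summit.QuantumFields.YangMills.Theorems.VirialFluxGap.FixFrame
open Summit.QuantumFields.YangMills.Theorems.VirialFluxGap.RegCutoff
open Summit.QuantumFields.YangMills.Theorems.VirialFluxGap.CentralField

variable {L : ℕ} [NeZero L]

open scoped Matrix.Norms.Frobenius

/-! ## §1 Closing arithmetic at scale `d ∈ (0, 1]`: `ρ = d·(10¹²L¹⁴)⁻¹`, `t_C = ρ²` -/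

omit [NeZero L] in
/-- ★ **The drive loss at scale `d`**: with `u = d·(10¹²L¹⁴)⁻¹` (`0 < d ≤ 1`, `L ≥ 1`),
`½[9216L⁴u² + (384L²u + 6(u + 16L²u))(3 + 147456L⁴(3L³ + 6L⁴))]·L⁴ ≤ d/400` (fcl-p3's ✓`closing_eps_bound` is the case `d = 1`). [folklore] -/
theorem closing_eps_bound_delta {Lr d : ℝ} (hL : 1 ≤ Lr) (hd0 : 0 < d) (hd1 : d ≤ 1) :
    (1 / 2) * (9216 * Lr ^ 4 * ((d * (10 ^ 12 * Lr ^ 14)⁻¹) * (d * (10 ^ 12 * Lr ^ 14)⁻¹)) +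
        (384 * Lr ^ 2 * (d * (10 ^ 12 * Lr ^ 14)⁻¹) + 6 * ((d * (10 ^ 12 * Lr ^ 14)⁻¹) + 16 * Lr ^ 2 * (d * (10 ^ 12 * Lr ^ 14)⁻¹))) *
          (3 + 147456 * Lr ^ 4 * (3 * Lr ^ 3 + 6 * Lr ^ 4))) * Lr ^ 4 ≤ d / 400 := by
  have hL0 : 0 < Lr := by linarith
  set u : ℝ := d * (10 ^ 12 * Lr ^ 14)⁻¹ with hu
  have hu0 : 0 < u := by rw [hu]; positivity
  have huL : u * Lr ^ 14 = d * (10 ^ 12 : ℝ)⁻¹ := by rw [hu]; field_simp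
  have hL2 : (1 : ℝ) ≤ Lr ^ 2 := one_le_pow₀ hL
  have hL3 : Lr ^ 3 ≤ Lr ^ 4 := pow_le_pow_right₀ hL (by norm_num)
  have hbr : 384 * Lr ^ 2 * u + 6 * (u + 16 * Lr ^ 2 * u) ≤ 492 * Lr ^ 2 * u := by nlinarith [mul_pos hu0 (lt_of_lt_of_le one_pos hL2)]
  have hN : 3 + 147456 * Lr ^ 4 * (3 * Lr ^ 3 + 6 * Lr ^ 4) ≤ 1327107 * Lr ^ 8 := by
    have h8 : (1 : ℝ) ≤ Lr ^ 8 := one_le_pow₀ hL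
    nlinarith [pow_pos hL0 4, hL3]
  have hfirst : 9216 * Lr ^ 4 * (u * u) ≤ u * Lr ^ 2 * Lr ^ 8 := by
    have hu1 : u ≤ (10 ^ 12 : ℝ)⁻¹ := by
      rw [hu]
      have h14 : (1 : ℝ) ≤ Lr ^ 14 := one_le_pow₀ hL
      have : (10 ^ 12 * Lr ^ 14 : ℝ)⁻¹ ≤ (10 ^ 12 : ℝ)⁻¹ := by
        rw [inv_le_inv₀ (by positivity) (by positivity)]; nlinarith
      calc d * (10 ^ 12 * Lr ^ 14)⁻¹ ≤ 1 * (10 ^ 12 : ℝ)⁻¹ := mul_le_mul hd1 this (by positivity) zero_le_one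
        _ = (10 ^ 12 : ℝ)⁻¹ := one_mul _
    have h6 : (1 : ℝ) ≤ Lr ^ 6 := one_le_pow₀ hL
    have : 9216 * u ≤ Lr ^ 6 := by nlinarith
    have key : u * Lr ^ 4 * (9216 * u) ≤ u * Lr ^ 4 * Lr ^ 6 := mul_le_mul_of_nonneg_left this (by positivity)
    calc 9216 * Lr ^ 4 * (u * u) = u * Lr ^ 4 * (9216 * u) := by ring
      _ ≤ u * Lr ^ 4 * Lr ^ 6 := key
      _ = u * Lr ^ 2 * Lr ^ 8 := by ring
  have hpos1 : 0 ≤ 3 + 147456 * Lr ^ 4 * (3 * Lr ^ 3 + 6 * Lr ^ 4) := by positivity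
  have hpos2 : 0 ≤ 492 * Lr ^ 2 * u := by positivity
  calc (1 / 2) * (9216 * Lr ^ 4 * (u * u) + (384 * Lr ^ 2 * u + 6 * (u + 16 * Lr ^ 2 * u)) *
          (3 + 147456 * Lr ^ 4 * (3 * Lr ^ 3 + 6 * Lr ^ 4))) * Lr ^ 4
      ≤ (1 / 2) * (u * Lr ^ 2 * Lr ^ 8 + (492 * Lr ^ 2 * u) * (1327107 * Lr ^ 8)) * Lr ^ 4 := by
        gcongr
    _ = (1 / 2) * (1 + 492 * 1327107) * (u * Lr ^ 14) := by ring
    _ ≤ d / 400 := by rw [huL]; norm_num; linarith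

omit [NeZero L] in
/-- ★ **The divergence excess at scale `d`**: with `ρ = d·(10¹²L¹⁴)⁻¹`, `12(ρ + 16L²ρ)² ≤ d/400`. [folklore] -/
theorem closing_div_excess_delta {Lr d : ℝ} (hL : 1 ≤ Lr) (hd0 : 0 < d) (hd1 : d ≤ 1) :
    12 * ((d * (10 ^ 12 * Lr ^ 14)⁻¹) + 16 * Lr ^ 2 * (d * (10 ^ 12 * Lr ^ 14)⁻¹)) ^ 2 ≤ d / 400 := by
  have hL0 : 0 < Lr := by linarith
  set u : ℝ := d * (10 ^ 12 * Lr ^ 14)⁻¹ with hu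
  have hu0 : 0 < u := by rw [hu]; positivity
  have hL2 : (1 : ℝ) ≤ Lr ^ 2 := one_le_pow₀ hL
  -- `u·L² ≤ d·10⁻¹²`
  have huL2 : u * Lr ^ 2 ≤ d * (10 ^ 12 : ℝ)⁻¹ := by
    rw [hu]
    have h12 : (1 : ℝ) ≤ Lr ^ 12 := one_le_pow₀ hL
    have e : d * (10 ^ 12 * Lr ^ 14)⁻¹ * Lr ^ 2 = d * (10 ^ 12 : ℝ)⁻¹ * (Lr ^ 12)⁻¹ := by
      field_simp
    rw [e]
    have : (Lr ^ 12 : ℝ)⁻¹ ≤ 1 := inv_le_one_of_one_le₀ h12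
    calc d * (10 ^ 12 : ℝ)⁻¹ * (Lr ^ 12)⁻¹ ≤ d * (10 ^ 12 : ℝ)⁻¹ * 1 := mul_le_mul_of_nonneg_left this (by positivity)
      _ = d * (10 ^ 12 : ℝ)⁻¹ := mul_one _
  have h17 : u + 16 * Lr ^ 2 * u ≤ 17 * (u * Lr ^ 2) := by nlinarith
  have h0 : 0 ≤ u + 16 * Lr ^ 2 * u := by positivity
  have hsq : (u + 16 * Lr ^ 2 * u) ^ 2 ≤ (17 * (d * (10 ^ 12 : ℝ)⁻¹)) ^ 2 :=
    pow_le_pow_left₀ h0 (h17.trans (by nlinarith)) 2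
  have hd2 : d ^ 2 ≤ d := by nlinarith
  calc 12 * (u + 16 * Lr ^ 2 * u) ^ 2 ≤ 12 * (17 * (d * (10 ^ 12 : ℝ)⁻¹)) ^ 2 := by linarith
    _ = 12 * 17 ^ 2 * (10 ^ 12 : ℝ)⁻¹ ^ 2 * d ^ 2 := by ring
    _ ≤ 12 * 17 ^ 2 * (10 ^ 12 : ℝ)⁻¹ ^ 2 * d := mul_le_mul_of_nonneg_left hd2 (by positivity)
    _ ≤ d / 400 := by rw [div_eq_mul_inv, mul_comm d]; exact mul_le_mul_of_nonneg_right (by norm_num) hd0.le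

omit [NeZero L] in
/-- The window inequalities at scale `d`: with `ρ = d·(10¹²L¹⁴)⁻¹`, `t_C = ρ²`, `K_C = 10²⁴/d²`:
`(K_C·L²⁸)⁻¹ = t_C`, `t_C ≤ ρ ≤ 1/5`, `ρ ≤ ½`, `t_C ≤ (110000L⁴)⁻¹`, `t_C ≤ (4096L⁴)⁻¹`, `330L² ≤ K_C·L²⁸`, `1 ≤ K_C`. [folklore] -/
theorem closing_window_bounds_delta {Lr d : ℝ} (hL : 1 ≤ Lr) (hd0 : 0 < d) (hd1 : d ≤ 1) :
    (10 ^ 24 / d ^ 2 * Lr ^ 28)⁻¹ = (d * (10 ^ 12 * Lr ^ 14)⁻¹) ^ 2 ∧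
    (d * (10 ^ 12 * Lr ^ 14)⁻¹) ^ 2 ≤ d * (10 ^ 12 * Lr ^ 14)⁻¹ ∧ d * (10 ^ 12 * Lr ^ 14)⁻¹ ≤ 1 / 5 ∧ d * (10 ^ 12 * Lr ^ 14)⁻¹ ≤ 1 / 2 ∧
    (d * (10 ^ 12 * Lr ^ 14)⁻¹) ^ 2 ≤ (110000 * Lr ^ 4)⁻¹ ∧ (d * (10 ^ 12 * Lr ^ 14)⁻¹) ^ 2 ≤ (4096 * Lr ^ 4)⁻¹ ∧
    330 * Lr ^ 2 ≤ 10 ^ 24 / d ^ 2 * Lr ^ 28 ∧ (1 : ℝ) ≤ 10 ^ 24 / d ^ 2 := by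
  have hL0 : 0 < Lr := by linarith
  set u : ℝ := d * (10 ^ 12 * Lr ^ 14)⁻¹ with hu
  have hu0 : 0 < u := by rw [hu]; positivity
  have h14 : (1 : ℝ) ≤ Lr ^ 14 := one_le_pow₀ hL
  have hu1 : u ≤ (10 ^ 12 : ℝ)⁻¹ := by
    rw [hu]
    have : (10 ^ 12 * Lr ^ 14 : ℝ)⁻¹ ≤ (10 ^ 12 : ℝ)⁻¹ := by
      rw [inv_le_inv₀ (by positivity) (by positivity)]; nlinarith
    calc d * (10 ^ 12 * Lr ^ 14)⁻¹ ≤ 1 * (10 ^ 12 : ℝ)⁻¹ := mul_le_mul hd1 this (by positivity) zero_le_one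
      _ = (10 ^ 12 : ℝ)⁻¹ := one_mul _
  have hule1 : u ≤ 1 := hu1.trans (by norm_num)
  have hd2inv : (1 : ℝ) ≤ 10 ^ 24 / d ^ 2 := by
    rw [le_div_iff₀ (by positivity)]
    have : d ^ 2 ≤ 1 := by nlinarith
    linarith
  refine ⟨?_, ?_, hu1.trans (by norm_num), hu1.trans (by norm_num), ?_, ?_, ?_, hd2inv⟩
  · rw [hu]; field_simp
  · nlinarith
  · -- `u² ≤ 10⁻²⁴ ≤ (110000 L⁴)⁻¹`? no: use `u² ≤ u·10⁻¹² ≤ d·10⁻²⁴·L⁻¹⁴ ≤ (110000L⁴)⁻¹`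
    have h1 : u ^ 2 ≤ u * (10 ^ 12 : ℝ)⁻¹ := by nlinarith
    have h2 : u * (10 ^ 12 : ℝ)⁻¹ ≤ (110000 * Lr ^ 4)⁻¹ := by
      rw [hu]
      have e : d * (10 ^ 12 * Lr ^ 14)⁻¹ * (10 ^ 12 : ℝ)⁻¹ = d / (10 ^ 24 * Lr ^ 14) := by field_simp
      rw [e, div_le_iff₀ (by positivity)]
      have h10 : (1 : ℝ) ≤ Lr ^ 10 := one_le_pow₀ hL
      have : (110000 * Lr ^ 4 : ℝ)⁻¹ * (10 ^ 24 * Lr ^ 14) = (10 ^ 24 / 110000) * Lr ^ 10 := by field_simp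
      rw [this]; nlinarith
    exact h1.trans h2
  · have h1 : u ^ 2 ≤ u * (10 ^ 12 : ℝ)⁻¹ := by nlinarith
    have h2 : u * (10 ^ 12 : ℝ)⁻¹ ≤ (4096 * Lr ^ 4)⁻¹ := by
      rw [hu]
      have e : d * (10 ^ 12 * Lr ^ 14)⁻¹ * (10 ^ 12 : ℝ)⁻¹ = d / (10 ^ 24 * Lr ^ 14) := by field_simp
      rw [e, div_le_iff₀ (by positivity)]
      have h10 : (1 : ℝ) ≤ Lr ^ 10 := one_le_pow₀ hL
      have : (4096 * Lr ^ 4 : ℝ)⁻¹ * (10 ^ 24 * Lr ^ 14) = (10 ^ 24 / 4096) * Lr ^ 10 := by field_simp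
      rw [this]; nlinarith
    exact h1.trans h2
  · have h28 : Lr ^ 2 ≤ Lr ^ 28 := pow_le_pow_right₀ hL (by norm_num)
    have hL2 : (0 : ℝ) ≤ Lr ^ 2 := by positivity
    have h330 : (330 : ℝ) ≤ 10 ^ 24 / d ^ 2 := by
      rw [le_div_iff₀ (by positivity)]
      have : d ^ 2 ≤ 1 := by nlinarith
      nlinarith
    calc 330 * Lr ^ 2 ≤ 10 ^ 24 / d ^ 2 * Lr ^ 2 := mul_le_mul_of_nonneg_right h330 hL2
      _ ≤ 10 ^ 24 / d ^ 2 * Lr ^ 28 := mul_le_mul_of_nonneg_left h28 (by positivity)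

/-! ## §2 The sign plug with a free divergence bound -/

/-- ★★ **The sign plug, free divergence bound `B`** (fcl-p3's ✓`centralPackage_of_signPlug` is the case `B = 18L⁴ − ½`): per-sign packages
(P2)(P3 with bound `B`)(P4) for `Φ σ σ₄` at the `ρ`-central window points carrying the signs (`ρ² ≤ ¾`) give the same three clauses for the
sign-plugged field `M ↦ Φ (linkSign · M) (seamSign M) va M` at every `ρ`-central window point (selectors locally constant:
✓`frameD_signPlug_eq`). [cite: Luscher1983, §2] -/
theorem centralPackage_of_signPlug_le {ρ t_C N ε_C B : ℝ} (hρ2 : ρ ^ 2 ≤ 3 / 4)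
    (Φ : (Fin 3 → ℝ) → ℝ → FixVar L × Fin 3 → ((Fin (2 * L - 1 + 1) → Edge 3 L → Matrix (Fin 2) (Fin 2) ℂ) × (Site 3 L → Matrix (Fin 2) (Fin 2) ℂ)) → ℝ)
    (hP : ∀ (σ : Fin 3 → ℝ) (σ₄ : ℝ), (∀ k, σ k = 1 ∨ σ k = -1) → (σ₄ = 1 ∨ σ₄ = -1) →
      ∀ x : (OffIdx L → SU2) × ((Fin (2 * L - 1) → GaugeConfig 3 L SU2) × (Site 3 L → SU2)),
      (∀ k : Fin 3, 1 - (su2Quat (wrapReps ((Fin.cons (glue x.1) x.2.1 : Fin (2 * L - 1 + 1) → GaugeConfig 3 L SU2) 0) k)).re ^ 2 ≤ ρ ^ 2) →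
      1 - (su2Quat (x.2.2 0)).re ^ 2 ≤ ρ ^ 2 →
      (∀ k : Fin 3, 1 / 2 ≤ σ k * (su2Quat (wrapReps ((Fin.cons (glue x.1) x.2.1 : Fin (2 * L - 1 + 1) → GaugeConfig 3 L SU2) 0) k)).re) →
      1 / 2 ≤ σ₄ * (su2Quat (x.2.2 0)).re →
      ringDeficit L (fun _ => false) ((Fin.cons (glue x.1) x.2.1 : Fin (2 * L - 1 + 1) → GaugeConfig 3 L SU2), x.2.2) ≤ t_C →
      2 * (1 - ε_C) * ringDeficit L (fun _ => false) ((Fin.cons (glue x.1) x.2.1 : Fin (2 * L - 1 + 1) → GaugeConfig 3 L SU2), x.2.2) ≤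
          ∑ va, Φ σ σ₄ va (ringCoord L ((Fin.cons (glue x.1) x.2.1 : Fin (2 * L - 1 + 1) → GaugeConfig 3 L SU2), x.2.2)) *
            frameGrad (L := L) fixFrameStd (ringCoord L ((Fin.cons (glue x.1) x.2.1 : Fin (2 * L - 1 + 1) → GaugeConfig 3 L SU2), x.2.2)) va ∧
        ∑ va, frameD (fixFrameStd va) (Φ σ σ₄ va) (ringCoord L ((Fin.cons (glue x.1) x.2.1 : Fin (2 * L - 1 + 1) → GaugeConfig 3 L SU2), x.2.2)) ≤ B ∧
        (∀ k : Fin 3, -(N * Real.sqrt (ringDeficit L (fun _ => false) ((Fin.cons (glue x.1) x.2.1 : Fin (2 * L - 1 + 1) → GaugeConfig 3 L SU2), x.2.2))) ≤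
          ∑ va, Φ σ σ₄ va (ringCoord L ((Fin.cons (glue x.1) x.2.1 : Fin (2 * L - 1 + 1) → GaugeConfig 3 L SU2), x.2.2)) *
            frameD (fixFrameStd va) (linkMass k) (ringCoord L ((Fin.cons (glue x.1) x.2.1 : Fin (2 * L - 1 + 1) → GaugeConfig 3 L SU2), x.2.2))) ∧
        -(N * Real.sqrt (ringDeficit L (fun _ => false) ((Fin.cons (glue x.1) x.2.1 : Fin (2 * L - 1 + 1) → GaugeConfig 3 L SU2), x.2.2))) ≤
          ∑ va, Φ σ σ₄ va (ringCoord L ((Fin.cons (glue x.1) x.2.1 : Fin (2 * L - 1 + 1) → GaugeConfig 3 L SU2), x.2.2)) *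
            frameD (fixFrameStd va) seamMass (ringCoord L ((Fin.cons (glue x.1) x.2.1 : Fin (2 * L - 1 + 1) → GaugeConfig 3 L SU2), x.2.2)))
    (x : (OffIdx L → SU2) × ((Fin (2 * L - 1) → GaugeConfig 3 L SU2) × (Site 3 L → SU2)))
    (hk : ∀ k : Fin 3, 1 - (su2Quat (wrapReps ((Fin.cons (glue x.1) x.2.1 : Fin (2 * L - 1 + 1) → GaugeConfig 3 L SU2) 0) k)).re ^ 2 ≤ ρ ^ 2)
    (hs : 1 - (su2Quat (x.2.2 0)).re ^ 2 ≤ ρ ^ 2)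
    (hF : ringDeficit L (fun _ => false) ((Fin.cons (glue x.1) x.2.1 : Fin (2 * L - 1 + 1) → GaugeConfig 3 L SU2), x.2.2) ≤ t_C) :
    2 * (1 - ε_C) * ringDeficit L (fun _ => false) ((Fin.cons (glue x.1) x.2.1 : Fin (2 * L - 1 + 1) → GaugeConfig 3 L SU2), x.2.2) ≤
        ∑ va, Φ (fun k => linkSign k (ringCoord L ((Fin.cons (glue x.1) x.2.1 : Fin (2 * L - 1 + 1) → GaugeConfig 3 L SU2), x.2.2)))
            (seamSign (ringCoord L ((Fin.cons (glue x.1) x.2.1 : Fin (2 * L - 1 + 1) → GaugeConfig 3 L SU2), x.2.2))) va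
            (ringCoord L ((Fin.cons (glue x.1) x.2.1 : Fin (2 * L - 1 + 1) → GaugeConfig 3 L SU2), x.2.2)) *
          frameGrad (L := L) fixFrameStd (ringCoord L ((Fin.cons (glue x.1) x.2.1 : Fin (2 * L - 1 + 1) → GaugeConfig 3 L SU2), x.2.2)) va ∧
      ∑ va, frameD (fixFrameStd va) (fun M' => Φ (fun k => linkSign k M') (seamSign M') va M')
          (ringCoord L ((Fin.cons (glue x.1) x.2.1 : Fin (2 * L - 1 + 1) → GaugeConfig 3 L SU2), x.2.2)) ≤ B ∧
      (∀ k : Fin 3, -(N * Real.sqrt (ringDeficit L (fun _ => false) ((Fin.cons (glue x.1) x.2.1 : Fin (2 * L - 1 + 1) → GaugeConfig 3 L SU2), x.2.2))) ≤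
        ∑ va, Φ (fun k => linkSign k (ringCoord L ((Fin.cons (glue x.1) x.2.1 : Fin (2 * L - 1 + 1) → GaugeConfig 3 L SU2), x.2.2)))
            (seamSign (ringCoord L ((Fin.cons (glue x.1) x.2.1 : Fin (2 * L - 1 + 1) → GaugeConfig 3 L SU2), x.2.2))) va
            (ringCoord L ((Fin.cons (glue x.1) x.2.1 : Fin (2 * L - 1 + 1) → GaugeConfig 3 L SU2), x.2.2)) *
          frameD (fixFrameStd va) (linkMass k) (ringCoord L ((Fin.cons (glue x.1) x.2.1 : Fin (2 * L - 1 + 1) → GaugeConfig 3 L SU2), x.2.2))) ∧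
      -(N * Real.sqrt (ringDeficit L (fun _ => false) ((Fin.cons (glue x.1) x.2.1 : Fin (2 * L - 1 + 1) → GaugeConfig 3 L SU2), x.2.2))) ≤
        ∑ va, Φ (fun k => linkSign k (ringCoord L ((Fin.cons (glue x.1) x.2.1 : Fin (2 * L - 1 + 1) → GaugeConfig 3 L SU2), x.2.2)))
            (seamSign (ringCoord L ((Fin.cons (glue x.1) x.2.1 : Fin (2 * L - 1 + 1) → GaugeConfig 3 L SU2), x.2.2))) va
            (ringCoord L ((Fin.cons (glue x.1) x.2.1 : Fin (2 * L - 1 + 1) → GaugeConfig 3 L SU2), x.2.2)) *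
          frameD (fixFrameStd va) seamMass (ringCoord L ((Fin.cons (glue x.1) x.2.1 : Fin (2 * L - 1 + 1) → GaugeConfig 3 L SU2), x.2.2)) := by
  set Mx := ringCoord L ((Fin.cons (glue x.1) x.2.1 : Fin (2 * L - 1 + 1) → GaugeConfig 3 L SU2), x.2.2) with hMx
  have hsel : ∀ k : Fin 3, (linkSign k Mx = 1 ∨ linkSign k Mx = -1) ∧
      1 / 2 ≤ linkSign k Mx * (su2Quat (wrapReps ((Fin.cons (glue x.1) x.2.1 : Fin (2 * L - 1 + 1) → GaugeConfig 3 L SU2) 0) k)).re := by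
    intro k
    rw [hMx, linkSign_fixEmbed]
    have h := signStep_central (r := (su2Quat (wrapReps ((Fin.cons (glue x.1) x.2.1 : Fin (2 * L - 1 + 1) → GaugeConfig 3 L SU2) 0) k)).re)
      (by linarith [hk k])
    exact ⟨h.1, h.2.2⟩
  have hselS : (seamSign Mx = 1 ∨ seamSign Mx = -1) ∧ 1 / 2 ≤ seamSign Mx * (su2Quat (x.2.2 0)).re := by
    rw [hMx, seamSign_ringCoord]
    have h := signStep_central (r := (su2Quat (x.2.2 0)).re) (by linarith [hs])
    exact ⟨h.1, h.2.2⟩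
  have hkm : ∀ k : Fin 3, linkMass k Mx ≤ 3 / 4 := fun k => by rw [hMx, linkMass_fixEmbed]; linarith [hk k]
  have hsm : seamMass Mx ≤ 3 / 4 := by rw [hMx, seamMass_fixEmbed]; linarith [hs]
  obtain ⟨h2, h3, h4, h5⟩ := hP (fun k => linkSign k Mx) (seamSign Mx) (fun k => (hsel k).1) hselS.1 x hk hs (fun k => (hsel k).2) hselS.2 hF
  refine ⟨h2, ?_, h4, h5⟩
  have e : ∀ va, frameD (fixFrameStd va) (fun M' => Φ (fun k => linkSign k M') (seamSign M') va M') Mx =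
      frameD (fixFrameStd va) (Φ (fun k => linkSign k Mx) (seamSign Mx) va) Mx := fun va =>
    frameD_signPlug_eq (fun σ σ₄ M' => Φ σ σ₄ va M') hkm hsm _
  simp only [e]
  exact h3

/-! ## §3 The `δ`-family of central field packages -/

/-- ★★ **The central field package at ONE `L` and scale `d ∈ (0,1]`**: `ρ = d·(10¹²L¹⁴)⁻¹`, `t_C = ρ²`, `N = 330L²`, the explicit loss
`ε_C = ½[9216L⁴t_C + (384L²√t_C + 6(ρ + 16L²√t_C))(3 + 147456L⁴(3L³ + 6L⁴))]` with `0 ≤ ε_C`, `ε_C·L⁴ ≤ d/400`, the sign-plugged explicit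
central field, and the three clauses (P2) (✓`central_drive_window'`), (P3) `≤ 18L⁴ − 3 + d/400` (✓`central_divergence_window_sharp` + §1),
(P4) (✓`central_*Mass_bracket_lower_window`) on the closed `ρ`-central window. [cite: Luscher1983, §2] [cite: CosteEtAl1985] -/
theorem centralFieldPackage_sharp_at {d : ℝ} (hd0 : 0 < d) (hd1 : d ≤ 1) :
    ∃ (ρ t_C N ε_C : ℝ)
      (C : FixVar L × Fin 3 → ((Fin (2 * L - 1 + 1) → Edge 3 L → Matrix (Fin 2) (Fin 2) ℂ) × (Site 3 L → Matrix (Fin 2) (Fin 2) ℂ)) → ℝ),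
      (10 ^ 24 / d ^ 2 * (L : ℝ) ^ 28)⁻¹ ≤ ρ ∧ ρ ≤ 1 / 2 ∧ (10 ^ 24 / d ^ 2 * (L : ℝ) ^ 28)⁻¹ ≤ t_C ∧ 0 ≤ N ∧ N ≤ 10 ^ 24 / d ^ 2 * (L : ℝ) ^ 28 ∧
      0 ≤ ε_C ∧ ε_C * (L : ℝ) ^ 4 ≤ d / 400 ∧ (∀ va, ContDiff ℝ ∞ (C va)) ∧
      ∀ x : (OffIdx L → SU2) × ((Fin (2 * L - 1) → GaugeConfig 3 L SU2) × (Site 3 L → SU2)),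
        (∀ k : Fin 3, 1 - (su2Quat (wrapReps ((Fin.cons (glue x.1) x.2.1 : Fin (2 * L - 1 + 1) → GaugeConfig 3 L SU2) 0) k)).re ^ 2 ≤ ρ ^ 2) →
        1 - (su2Quat (x.2.2 0)).re ^ 2 ≤ ρ ^ 2 →
        ringDeficit L (fun _ => false) ((Fin.cons (glue x.1) x.2.1 : Fin (2 * L - 1 + 1) → GaugeConfig 3 L SU2), x.2.2) ≤ t_C →
        2 * (1 - ε_C) * ringDeficit L (fun _ => false) ((Fin.cons (glue x.1) x.2.1 : Fin (2 * L - 1 + 1) → GaugeConfig 3 L SU2), x.2.2) ≤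
            ∑ va, C va (ringCoord L ((Fin.cons (glue x.1) x.2.1 : Fin (2 * L - 1 + 1) → GaugeConfig 3 L SU2), x.2.2)) *
              frameGrad (L := L) fixFrameStd (ringCoord L ((Fin.cons (glue x.1) x.2.1 : Fin (2 * L - 1 + 1) → GaugeConfig 3 L SU2), x.2.2)) va ∧
          ∑ va, frameD (fixFrameStd va) (C va) (ringCoord L ((Fin.cons (glue x.1) x.2.1 : Fin (2 * L - 1 + 1) → GaugeConfig 3 L SU2), x.2.2)) ≤
            18 * (L : ℝ) ^ 4 - 3 + d / 400 ∧
          (∀ k : Fin 3, -(N * Real.sqrt (ringDeficit L (fun _ => false) ((Fin.cons (glue x.1) x.2.1 : Fin (2 * L - 1 + 1) → GaugeConfig 3 L SU2), x.2.2))) ≤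
            ∑ va, C va (ringCoord L ((Fin.cons (glue x.1) x.2.1 : Fin (2 * L - 1 + 1) → GaugeConfig 3 L SU2), x.2.2)) *
              frameD (fixFrameStd va) (linkMass k) (ringCoord L ((Fin.cons (glue x.1) x.2.1 : Fin (2 * L - 1 + 1) → GaugeConfig 3 L SU2), x.2.2))) ∧
          -(N * Real.sqrt (ringDeficit L (fun _ => false) ((Fin.cons (glue x.1) x.2.1 : Fin (2 * L - 1 + 1) → GaugeConfig 3 L SU2), x.2.2))) ≤
            ∑ va, C va (ringCoord L ((Fin.cons (glue x.1) x.2.1 : Fin (2 * L - 1 + 1) → GaugeConfig 3 L SU2), x.2.2)) *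
              frameD (fixFrameStd va) seamMass (ringCoord L ((Fin.cons (glue x.1) x.2.1 : Fin (2 * L - 1 + 1) → GaugeConfig 3 L SU2), x.2.2)) := by
  have hL1 : (1 : ℝ) ≤ (L : ℝ) := by exact_mod_cast NeZero.one_le
  have hL0 : (0 : ℝ) < (L : ℝ) := by positivity
  obtain ⟨hKt, htρ, hρ5, hρ2', ht110, ht4096, hN, -⟩ := closing_window_bounds_delta hL1 hd0 hd1
  set ρ : ℝ := d * (10 ^ 12 * (L : ℝ) ^ 14)⁻¹ with hρdef
  have hρ0 : 0 ≤ ρ := by rw [hρdef]; positivity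
  have hsq : Real.sqrt (ρ ^ 2) = ρ := Real.sqrt_sq hρ0
  set ε_C : ℝ := (1 / 2 : ℝ) * (9216 * (L : ℝ) ^ 4 * ρ ^ 2 +
      (384 * (L : ℝ) ^ 2 * Real.sqrt (ρ ^ 2) + 6 * (ρ + 16 * (L : ℝ) ^ 2 * Real.sqrt (ρ ^ 2))) *
        (3 + 147456 * (L : ℝ) ^ 4 * (3 * (L : ℝ) ^ 3 + 6 * (L : ℝ) ^ 4))) with hεdef
  have hε0 : 0 ≤ ε_C := by rw [hεdef]; positivity
  have hεL : ε_C * (L : ℝ) ^ 4 ≤ d / 400 := by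
    rw [hεdef, hsq, show ρ ^ 2 = ρ * ρ from sq ρ]
    exact closing_eps_bound_delta hL1 hd0 hd1
  have hdiv : 12 * (ρ + 16 * (L : ℝ) ^ 2 * Real.sqrt (ρ ^ 2)) ^ 2 ≤ d / 400 := by
    rw [hsq]; exact closing_div_excess_delta hL1 hd0 hd1
  have hρq : ρ ^ 2 ≤ 1 / 4 := by nlinarith [hρ2']
  refine ⟨ρ, ρ ^ 2, 330 * (L : ℝ) ^ 2, ε_C, fun va M => centralCoeff L (fun k => linkSign k M) (seamSign M) va M,
    hKt.le.trans htρ, hρ2', hKt.le, by positivity, hN, hε0, hεL, fun va => contDiff_centralCoeff_sign (L := L) va, fun x hk hs hF => ?_⟩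
  have hρ34 : ρ ^ 2 ≤ 3 / 4 := by linarith [hρq]
  refine centralPackage_of_signPlug_le (L := L) hρ34 (fun σ σ₄ va M => centralCoeff L σ σ₄ va M) (fun σ σ₄ hσ hσ₄ y hk' hs' hW hS hF' => ?_) x hk hs hF
  have hF110 : ringDeficit L (fun _ => false) ((Fin.cons (glue y.1) y.2.1 : Fin (2 * L - 1 + 1) → GaugeConfig 3 L SU2), y.2.2) ≤
      (110000 * (L : ℝ) ^ 4)⁻¹ := hF'.trans ht110
  refine ⟨central_drive_window' hσ hσ₄ y hρ0 hρ5 ht4096 hk' hs' hW hS hF', ?_,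
    fun k => central_linkMass_bracket_lower_window (L := L) hσ σ₄ y k (hW k) ((hk' k).trans hρq) hF110,
    central_seamMass_bracket_lower_window (L := L) σ hσ₄ y hS (hs'.trans hρq) hF110⟩
  have h3 := central_divergence_window_sharp hσ hσ₄ y hρ0 hρ5 ht4096 hk' hs' hF'
  linarith [h3, hdiv]

/-- ★★★ **THE `δ`-FAMILY OF CENTRAL FIELD PACKAGES, SHARP COUNT.**  For every `δ > 0`: `K_C = 10²⁴/min(δ,1)² ≥ 1`, `q_C = 28`, `L₀ = 1`, and for
every `L ≥ 1` a radius `ρ ∈ [(K_C L^{q_C})⁻¹, ½]`, a window `t_C ≥ (K_C L^{q_C})⁻¹`, a rate `0 ≤ N ≤ K_C L^{q_C}`, a loss `0 ≤ ε_C` with `ε_C·L⁴ ≤ δ`,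
SMOOTH coefficient functions `C_va` (the sign-plugged explicit central field), such that at every point of `X_fix` in the closed `ρ`-central
window: (P2) `2(1−ε_C)F_fix ≤ Σ C·g`, (P3) `Σ ∂C ≤ 18L⁴ − 3 + δ`, (P4) `−N√F_fix ≤ Σ C·∂m` for the four masses — the «CentralFieldPackage» of
✓`periodicSoftness_of_centralField` with the sharp divergence and a `δ`-small loss, i.e. the central input of the `δ`-rerun of the ⟨24141⟩
assembly toward ✓`gibbsMeanWindow_of_smoothFrameFieldFamily_cutoff` ⟹ ⟨24196⟩. [cite: Luscher1983, §2] [cite: CosteEtAl1985] -/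
theorem centralFieldFamily_sharp (δ : ℝ) (hδ : 0 < δ) :
    ∃ K_C : ℝ, 1 ≤ K_C ∧ ∃ q_C : ℕ, ∃ L₀ : ℕ, ∀ (L : ℕ) [NeZero L], L₀ ≤ L →
      ∃ (ρ t_C N ε_C : ℝ)
        (C : FixVar L × Fin 3 → ((Fin (2 * L - 1 + 1) → Edge 3 L → Matrix (Fin 2) (Fin 2) ℂ) × (Site 3 L → Matrix (Fin 2) (Fin 2) ℂ)) → ℝ),
        (K_C * (L : ℝ) ^ q_C)⁻¹ ≤ ρ ∧ ρ ≤ 1 / 2 ∧ (K_C * (L : ℝ) ^ q_C)⁻¹ ≤ t_C ∧ 0 ≤ N ∧ N ≤ K_C * (L : ℝ) ^ q_C ∧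
        0 ≤ ε_C ∧ ε_C * (L : ℝ) ^ 4 ≤ δ ∧ (∀ va, ContDiff ℝ ∞ (C va)) ∧
        ∀ x : (OffIdx L → SU2) × ((Fin (2 * L - 1) → GaugeConfig 3 L SU2) × (Site 3 L → SU2)),
          (∀ k : Fin 3, 1 - (su2Quat (wrapReps ((Fin.cons (glue x.1) x.2.1 : Fin (2 * L - 1 + 1) → GaugeConfig 3 L SU2) 0) k)).re ^ 2 ≤ ρ ^ 2) →
          1 - (su2Quat (x.2.2 0)).re ^ 2 ≤ ρ ^ 2 →
          ringDeficit L (fun _ => false) ((Fin.cons (glue x.1) x.2.1 : Fin (2 * L - 1 + 1) → GaugeConfig 3 L SU2), x.2.2) ≤ t_C →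
          2 * (1 - ε_C) * ringDeficit L (fun _ => false) ((Fin.cons (glue x.1) x.2.1 : Fin (2 * L - 1 + 1) → GaugeConfig 3 L SU2), x.2.2) ≤
              ∑ va, C va (ringCoord L ((Fin.cons (glue x.1) x.2.1 : Fin (2 * L - 1 + 1) → GaugeConfig 3 L SU2), x.2.2)) *
                frameGrad (L := L) fixFrameStd (ringCoord L ((Fin.cons (glue x.1) x.2.1 : Fin (2 * L - 1 + 1) → GaugeConfig 3 L SU2), x.2.2)) va ∧
            ∑ va, frameD (fixFrameStd va) (C va) (ringCoord L ((Fin.cons (glue x.1) x.2.1 : Fin (2 * L - 1 + 1) → GaugeConfig 3 L SU2), x.2.2)) ≤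
              18 * (L : ℝ) ^ 4 - 3 + δ ∧
            (∀ k : Fin 3, -(N * Real.sqrt (ringDeficit L (fun _ => false) ((Fin.cons (glue x.1) x.2.1 : Fin (2 * L - 1 + 1) → GaugeConfig 3 L SU2), x.2.2))) ≤
              ∑ va, C va (ringCoord L ((Fin.cons (glue x.1) x.2.1 : Fin (2 * L - 1 + 1) → GaugeConfig 3 L SU2), x.2.2)) *
                frameD (fixFrameStd va) (linkMass k) (ringCoord L ((Fin.cons (glue x.1) x.2.1 : Fin (2 * L - 1 + 1) → GaugeConfig 3 L SU2), x.2.2))) ∧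
            -(N * Real.sqrt (ringDeficit L (fun _ => false) ((Fin.cons (glue x.1) x.2.1 : Fin (2 * L - 1 + 1) → GaugeConfig 3 L SU2), x.2.2))) ≤
              ∑ va, C va (ringCoord L ((Fin.cons (glue x.1) x.2.1 : Fin (2 * L - 1 + 1) → GaugeConfig 3 L SU2), x.2.2)) *
                frameD (fixFrameStd va) seamMass (ringCoord L ((Fin.cons (glue x.1) x.2.1 : Fin (2 * L - 1 + 1) → GaugeConfig 3 L SU2), x.2.2)) := by
  set d : ℝ := min δ 1 with hddef
  have hd0 : 0 < d := lt_min hδ one_pos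
  have hd1 : d ≤ 1 := min_le_right _ _
  have hdδ : d ≤ δ := min_le_left _ _
  have hK : (1 : ℝ) ≤ 10 ^ 24 / d ^ 2 := by
    rw [le_div_iff₀ (by positivity)]
    have : d ^ 2 ≤ 1 := by nlinarith
    linarith
  refine ⟨10 ^ 24 / d ^ 2, hK, 28, 1, fun L _ _ => ?_⟩
  obtain ⟨ρ, t_C, N, ε_C, C, hρlo, hρhi, htC, hN0, hN, hε0, hεL, hCs, hP⟩ := centralFieldPackage_sharp_at (L := L) hd0 hd1
  have e28 : (10 : ℝ) ^ 24 / d ^ 2 * (L : ℝ) ^ (28 : ℕ) = 10 ^ 24 / d ^ 2 * (L : ℝ) ^ 28 := rfl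
  refine ⟨ρ, t_C, N, ε_C, C, hρlo, hρhi, htC, hN0, hN, hε0, hεL.trans (by linarith), hCs, fun x hk hs hF => ?_⟩
  obtain ⟨h2, h3, h4, h5⟩ := hP x hk hs hF
  exact ⟨h2, h3.trans (by linarith), h4, h5⟩

end Summit.QuantumFields.YangMills.Theorems.VirialFluxGap.FrameHessian

end
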